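import Summits.HodgeConjecture.HodgeConjecture.Theorems.Ring2WeilCoverageResidueDictionary
import HarnessLib

/-!
# Weil-type family coverage — the residue dictionary for the IMAGINARY QUADRATIC PIECES `i, √−3, √−2, √−7`:
# for `φ ζ = 𝐞(t)`, `Im φ(δ_K) < 0` iff the unit residue `t` moves the index set of `δ_K` onto its negative —
# a decidable predicate of `t mod f_K`

research route conditional on HC_CM; not a corollary; Q11.4-sentence-2 already refuted in dim ≥ 3.

Ring 2, WEIL-TYPE FAMILY-COVERAGE CENSUS (`HOME/WEIL-FAMILY-COVERAGE.md` `## b01`, blocks b01.23 (C)/(D), b01.34 (E),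
b01.36; owner ring2-b01), part 26 of the `Ring2WeilCoverage*` series.  Part 25 (`…ResidueDictionary`) proved: for
`δ = c₀ + c·Σ_{a∈S} ζ^{(n/f)·a}` with (H1) every unit `s` carries `S` onto `S` or onto `S′`, (H2)
`c(Σ_S 𝐞_f + Σ_{S′} 𝐞_f) + 2c₀ = 0`, (H3) `Im δ(𝐞_f(1)) > 0`, an embedding `φ` reading the unit residue `t` has
`Im φ(δ) < 0 ↔ t·S = S′`.  Here (H1)–(H3) are discharged for the Gauss-sum generators of four of the five imaginary
quadratic fields of prime-power conductor that occur in the census (`√−11` and the real pieces are part 26b):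

| `K` | `f` | `δ_K` | `S` | `S′` | (H3) |
|---|---|---|---|---|---|
| `ℚ(i)` | 4 | `ζ^{n/4}` | `{1}` | `{3}` | `sin(π/2) = 1` |
| `ℚ(√−3)` | 3 | `1 + 2ζ^{n/3}` | `{1}` | `{2}` | `sin(2π/3) > 0` |
| `ℚ(√−2)` | 8 | `ζ^{n/8} + ζ^{3n/8}` | `{1,3}` | `{5,7}` | `sin(π/4), sin(3π/4) > 0` |
| `ℚ(√−7)` | 7 | `1 + 2(η + η² + η⁴)`, `η = ζ^{n/7}` | `{1,2,4}` | `{3,5,6}` | `sin(2π/7) > sin(π/7)`, `sin(4π/7) > 0` |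

((H1) by `decide`; (H2) from `Σ_{k<f} 𝐞_f(1)^k = 0`, resp. `𝐞_f(1)^{f/2} = −1`.)  Main statements
(`im_embedding_…_neg_iff`, for ANY level `n` with `f ∣ n`, any field `K ∋ ζ`, any embedding `φ` with `φ ζ = 𝐞_n(t)`,
`t` a unit residue): **`Im φ(δ_K) < 0 ↔ S.image (· * (t mod f)) = S′`**, `Im φ(δ_K) ≠ 0`, `Re φ(δ_K) = 0` — e.g.
`Im φ(ζ^{n/4}) < 0 ↔ t ≡ 3 (mod 4)`, `Im φ(1 + 2ζ^{n/3}) < 0 ↔ t ≡ 2 (mod 3)`,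
`Im φ(1 + 2(η+η²+η⁴)) < 0 ↔ t mod 7 ∈ {3,5,6}`.  Since `φ(δ_K)² < 0`… more to the point, since every embedding of
`ℚ(ζₙ)` restricts on `K = ℚ(δ_K)` to one of the two embeddings of `K`, distinguished by the sign of `Im φ(δ_K)`,
this is the kernel form of «`σ_t` acts as complex conjugation on `K` iff `t ∈ N_K`»; part 27 identifies the census's
displayed sets `N_K` with these predicates, level by level.

HONEST FRAMING: elementary trigonometry and finite sums; nothing here mentions Hodge classes, polarisations, `W_K`
or HC; `HC_CM` is used nowhere.  No `def`, no named fact, no `sorry`.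

References: [cite: Washington1997, Lemma 4.7–4.8 and §8.1]; [cite: Aoki2002CMFermatType, §1 (p. 102)]; census b01.34
(E) «the residue sets are docstring-level» (seat-derived).
-/

noncomputable section

open Complex Finset
open scoped Real

namespace Summit.HodgeConjecture.Ring2WeilCoverage.ResidueDictionaryPieces

open Summit.HodgeConjecture.Ring2WeilCoverage.ResidueDictionary

/-- `𝐞(x) = exp(2πi x/f) ∈ ℂ` (`ZMod.toCircle` at the level of `x`). -/
local notation3 (prettyPrint := false) "𝐞 " t:max => ((ZMod.toCircle t : Circle) : ℂ)

/-! ### §0 Helpers: `𝐞_f(k) = 𝐞_f(1)^k`, `𝐞_f(1)` is a primitive `f`-th root, real and imaginary parts -/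

section Helpers
variable {f : ℕ} [NeZero f]

/-- `𝐞_f(k) = 𝐞_f(1)^k` for a natural number `k`.
research route conditional on HC_CM; not a corollary; Q11.4-sentence-2 already refuted in dim ≥ 3. [folklore] -/
theorem toCircle_natCast_eq_pow (k : ℕ) : 𝐞 ((k : ℕ) : ZMod f) = (𝐞 (1 : ZMod f)) ^ k := by
  rw [show ((k : ℕ) : ZMod f) = k • (1 : ZMod f) from (nsmul_one k).symm, AddChar.map_nsmul_eq_pow]
  push_cast
  rfl

/-- `Im 𝐞_f(1)^k = sin(2πk/f)`, `Re 𝐞_f(1)^k = cos(2πk/f)`.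
research route conditional on HC_CM; not a corollary; Q11.4-sentence-2 already refuted in dim ≥ 3. [folklore] -/
theorem im_re_toCircle_one_pow (k : ℕ) :
    ((𝐞 (1 : ZMod f)) ^ k).im = Real.sin (2 * π * k / f) ∧ ((𝐞 (1 : ZMod f)) ^ k).re = Real.cos (2 * π * k / f) := by
  rw [← toCircle_natCast_eq_pow, ZMod.toCircle_natCast,
    show (2 * π * I * k / f : ℂ) = ((2 * π * k / f : ℝ) : ℂ) * I by push_cast; ring,
    Complex.exp_ofReal_mul_I_im, Complex.exp_ofReal_mul_I_re]
  exact ⟨rfl, rfl⟩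

/-- `𝐞_f(1) = exp(2πi/f)`.
research route conditional on HC_CM; not a corollary; Q11.4-sentence-2 already refuted in dim ≥ 3. [folklore] -/
theorem toCircle_one_eq_exp : 𝐞 (1 : ZMod f) = cexp (2 * π * I / f) := by
  rw [show (1 : ZMod f) = ((1 : ℕ) : ZMod f) by norm_num, ZMod.toCircle_natCast]
  push_cast
  ring_nf

/-- `Σ_{k<f} 𝐞_f(1)^k = 0` for `f ≥ 2` (`𝐞_f(1)` is a primitive `f`-th root of unity).
research route conditional on HC_CM; not a corollary; Q11.4-sentence-2 already refuted in dim ≥ 3. [folklore] -/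
theorem geom_sum_toCircle_one (hf : 1 < f) : ∑ k ∈ Finset.range f, (𝐞 (1 : ZMod f)) ^ k = 0 := by
  have h := Complex.isPrimitiveRoot_exp f (NeZero.ne f)
  rw [← toCircle_one_eq_exp] at h
  exact h.geom_sum_eq_zero hf

/-- `𝐞_f(1)^{f/2} = −1` for even `f`.
research route conditional on HC_CM; not a corollary; Q11.4-sentence-2 already refuted in dim ≥ 3. [folklore] -/
theorem toCircle_one_pow_half (hf : Even f) : (𝐞 (1 : ZMod f)) ^ (f / 2) = -1 := by
  rw [toCircle_one_eq_exp, ← Complex.exp_nat_mul]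
  have hf0 : (f : ℂ) ≠ 0 := Nat.cast_ne_zero.mpr (NeZero.ne f)
  obtain ⟨m, hm⟩ := hf
  have hm' : f / 2 = m := by omega
  rw [hm', show ((m : ℕ) : ℂ) * (2 * π * I / f) = π * I by
    rw [show (f : ℂ) = 2 * m by exact_mod_cast (by omega : f = 2 * m)]
    have hm0 : (m : ℂ) ≠ 0 := by
      have : m ≠ 0 := by rintro rfl; exact NeZero.ne f (by omega)
      exact Nat.cast_ne_zero.mpr this
    field_simp]
  exact Complex.exp_pi_mul_I

/-- `Im 𝐞_f(k) = sin(2πk/f)` and `Re 𝐞_f(k) = cos(2πk/f)`.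
research route conditional on HC_CM; not a corollary; Q11.4-sentence-2 already refuted in dim ≥ 3. [folklore] -/
theorem im_re_toCircle_natCast (k : ℕ) :
    (𝐞 ((k : ℕ) : ZMod f)).im = Real.sin (2 * π * k / f) ∧ (𝐞 ((k : ℕ) : ZMod f)).re = Real.cos (2 * π * k / f) := by
  rw [ZMod.toCircle_natCast, show (2 * π * I * k / f : ℂ) = ((2 * π * k / f : ℝ) : ℂ) * I by push_cast; ring,
    Complex.exp_ofReal_mul_I_im, Complex.exp_ofReal_mul_I_re]
  exact ⟨rfl, rfl⟩

/-- `Im 𝐞_f(1) = sin(2π/f)`, `Re 𝐞_f(1) = cos(2π/f)`.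
research route conditional on HC_CM; not a corollary; Q11.4-sentence-2 already refuted in dim ≥ 3. [folklore] -/
theorem im_re_toCircle_one :
    (𝐞 (1 : ZMod f)).im = Real.sin (2 * π * (1 : ℕ) / f) ∧ (𝐞 (1 : ZMod f)).re = Real.cos (2 * π * (1 : ℕ) / f) := by
  have h := im_re_toCircle_one_pow (f := f) 1
  rwa [pow_one] at h

end Helpers

variable {K : Type} [Field K] {n : ℕ} [NeZero n] {ζ : K}

/-! ### §1 `K = ℚ(i)`: `δ = ζ^{n/4}`, `f = 4`, `S = {1}`, `S′ = {3}` -/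

/-- (H1)–(H3) at `f = 4`: units `s` mod 4 carry `{1}` to `{1}` or `{3}`; `𝐞₄(1) + 𝐞₄(3) = 0`; `Im 𝐞₄(1) = 1 > 0`.
research route conditional on HC_CM; not a corollary; Q11.4-sentence-2 already refuted in dim ≥ 3. [folklore] -/
theorem hyps_four :
    (∀ s : ZMod 4, IsUnit s → ({1} : Finset (ZMod 4)).image (· * s) = {1} ∨
        ({1} : Finset (ZMod 4)).image (· * s) = {3}) ∧
      (((1 : ℕ) : ℂ) * (∑ a ∈ ({1} : Finset (ZMod 4)), 𝐞 a + ∑ a ∈ ({3} : Finset (ZMod 4)), 𝐞 a) +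
          2 * ((0 : ℕ) : ℂ) = 0) ∧
      0 < ((((0 : ℕ) : ℂ)) + ((1 : ℕ) : ℂ) * ∑ a ∈ ({1} : Finset (ZMod 4)), 𝐞 a).im := by
  refine ⟨fun s hs => ?_, ?_, ?_⟩
  · obtain ⟨u, rfl⟩ := hs
    have := ZMod.val_coe_unit_coprime u
    revert this; generalize (u : ZMod 4) = s; revert s; decide
  · simp only [Finset.sum_singleton, Nat.cast_one, one_mul, Nat.cast_zero, mul_zero, add_zero]
    have h2 : (𝐞 (1 : ZMod 4)) ^ 2 = -1 := by
      have := toCircle_one_pow_half (f := 4) (by decide)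
      norm_num at this
      exact this
    rw [show (3 : ZMod 4) = ((3 : ℕ) : ZMod 4) by norm_num, toCircle_natCast_eq_pow]
    linear_combination (𝐞 (1 : ZMod 4)) * h2
  · simp only [Finset.sum_singleton, Nat.cast_one, one_mul, Nat.cast_zero, zero_add]
    rw [show (1 : ZMod 4) = ((1 : ℕ) : ZMod 4) by norm_num, (im_re_toCircle_natCast 1).1,
      show (2 * π * (1 : ℕ) / (4 : ℕ) : ℝ) = π / 2 by push_cast; ring, Real.sin_pi_div_two]
    exact one_pos

/-- **`K = ℚ(i)`, any level `n` with `4 ∣ n`: `Im φ(ζ^{n/4}) < 0 ↔ t mod 4 = 3`** (as `{1}·t = {3}` in `ℤ/4`),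
`Im φ(ζ^{n/4}) ≠ 0`, `Re φ(ζ^{n/4}) = 0`, for `φ ζ = 𝐞_n(t)`, `t` a unit residue.  (`ζ^{n/4} = i` up to the
embedding; `σ_t` is complex conjugation on `ℚ(i)` iff `χ_{−4}(t) = −1`.)
research route conditional on HC_CM; not a corollary; Q11.4-sentence-2 already refuted in dim ≥ 3. [folklore] -/
theorem im_embedding_sqrtNegOne_neg_iff (h4 : 4 ∣ n) {φ : K →+* ℂ} {t : ZMod n} (hφ : φ ζ = 𝐞 t)
    (ht : t.val.Coprime n) :
    (((φ (ζ ^ (n / 4))).im < 0 ↔ ({1} : Finset (ZMod 4)).image (· * ((t.val : ℕ) : ZMod 4)) = {3}) ∧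
      (φ (ζ ^ (n / 4))).im ≠ 0) ∧ (φ (ζ ^ (n / 4))).re = 0 := by
  obtain ⟨H1, H2, H3⟩ := hyps_four
  have hu := isUnit_cast_of_coprime h4 ht
  have hre0 := re_charSum_one_eq_zero ({1} : Finset (ZMod 4)) {3} 0 1 H2 (by decide)
  have hv : (1 : ZMod 4).val = 1 := rfl
  have helt : ζ ^ (n / 4) = ((0 : ℕ) : K) + (1 : ℕ) * ∑ a ∈ ({1} : Finset (ZMod 4)), ζ ^ (n / 4 * a.val) := by
    simp [hv]
  rw [helt, embedding_charSum_eq h4 hφ]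
  exact ⟨im_charSum_neg_iff _ _ 0 1 H1 H2 H3 hu, re_charSum_eq_zero _ _ 0 1 H1 H2 hre0 hu⟩

/-! ### §2 `K = ℚ(√−3)`: `δ = 1 + 2ζ^{n/3}`, `f = 3`, `S = {1}`, `S′ = {2}` -/

/-- (H1)–(H3) at `f = 3`: units carry `{1}` to `{1}` or `{2}`; `2(𝐞₃(1) + 𝐞₃(2)) + 2 = 0`; `Im(1 + 2𝐞₃(1)) > 0`.
research route conditional on HC_CM; not a corollary; Q11.4-sentence-2 already refuted in dim ≥ 3. [folklore] -/
theorem hyps_three :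
    (∀ s : ZMod 3, IsUnit s → ({1} : Finset (ZMod 3)).image (· * s) = {1} ∨
        ({1} : Finset (ZMod 3)).image (· * s) = {2}) ∧
      (((2 : ℕ) : ℂ) * (∑ a ∈ ({1} : Finset (ZMod 3)), 𝐞 a + ∑ a ∈ ({2} : Finset (ZMod 3)), 𝐞 a) +
          2 * ((1 : ℕ) : ℂ) = 0) ∧
      0 < ((((1 : ℕ) : ℂ)) + ((2 : ℕ) : ℂ) * ∑ a ∈ ({1} : Finset (ZMod 3)), 𝐞 a).im := by
  refine ⟨fun s hs => ?_, ?_, ?_⟩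
  · obtain ⟨u, rfl⟩ := hs
    have := ZMod.val_coe_unit_coprime u
    revert this; generalize (u : ZMod 3) = s; revert s; decide
  · simp only [Finset.sum_singleton]
    have hg := geom_sum_toCircle_one (f := 3) (by norm_num)
    simp only [Finset.sum_range_succ, Finset.sum_range_zero, zero_add, pow_zero, pow_one] at hg
    rw [show (2 : ZMod 3) = ((2 : ℕ) : ZMod 3) by norm_num, toCircle_natCast_eq_pow]
    push_cast
    linear_combination 2 * hg
  · simp only [Finset.sum_singleton]
    rw [show (1 : ZMod 3) = ((1 : ℕ) : ZMod 3) by norm_num]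
    have him := (im_re_toCircle_natCast (f := 3) 1).1
    simp only [Complex.add_im, Complex.natCast_im, Complex.mul_im, Complex.natCast_re, zero_mul, add_zero,
      zero_add, him]
    have : 0 < Real.sin (2 * π * (1 : ℕ) / (3 : ℕ)) := by
      apply Real.sin_pos_of_pos_of_lt_pi
      · positivity
      · have := Real.pi_pos; push_cast; nlinarith
    push_cast
    nlinarith

/-- **`K = ℚ(√−3)`, any level `n` with `3 ∣ n`: `Im φ(1 + 2ζ^{n/3}) < 0 ↔ t mod 3 = 2`** (as `{1}·t = {2}` in
`ℤ/3`), non-zero, `Re = 0`, for `φ ζ = 𝐞_n(t)`, `t` a unit residue.  (`1 + 2ζ^{n/3} = √−3` up to the embedding.)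
research route conditional on HC_CM; not a corollary; Q11.4-sentence-2 already refuted in dim ≥ 3. [folklore] -/
theorem im_embedding_sqrtNegThree_neg_iff (h3 : 3 ∣ n) {φ : K →+* ℂ} {t : ZMod n} (hφ : φ ζ = 𝐞 t)
    (ht : t.val.Coprime n) :
    (((φ (1 + 2 * ζ ^ (n / 3))).im < 0 ↔ ({1} : Finset (ZMod 3)).image (· * ((t.val : ℕ) : ZMod 3)) = {2}) ∧
      (φ (1 + 2 * ζ ^ (n / 3))).im ≠ 0) ∧ (φ (1 + 2 * ζ ^ (n / 3))).re = 0 := by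
  obtain ⟨H1, H2, H3⟩ := hyps_three
  have hu := isUnit_cast_of_coprime h3 ht
  have hre0 := re_charSum_one_eq_zero ({1} : Finset (ZMod 3)) {2} 1 2 H2 (by decide)
  have hv : (1 : ZMod 3).val = 1 := rfl
  have helt : (1 + 2 * ζ ^ (n / 3) : K) =
      ((1 : ℕ) : K) + (2 : ℕ) * ∑ a ∈ ({1} : Finset (ZMod 3)), ζ ^ (n / 3 * a.val) := by
    simp [hv]
  rw [helt, embedding_charSum_eq h3 hφ]
  exact ⟨im_charSum_neg_iff _ _ 1 2 H1 H2 H3 hu, re_charSum_eq_zero _ _ 1 2 H1 H2 hre0 hu⟩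

/-! ### §3 `K = ℚ(√−2)`: `δ = ζ^{n/8} + ζ^{3n/8}`, `f = 8`, `S = {1,3}`, `S′ = {5,7}` -/

/-- (H1)–(H3) at `f = 8` for `S = {1,3}`: units carry `S` to `S` or `{5,7}`; `Σ_{odd k} 𝐞₈(k) = 0`;
`Im(𝐞₈(1) + 𝐞₈(3)) > 0`.
research route conditional on HC_CM; not a corollary; Q11.4-sentence-2 already refuted in dim ≥ 3. [folklore] -/
theorem hyps_eight :
    (∀ s : ZMod 8, IsUnit s → ({1, 3} : Finset (ZMod 8)).image (· * s) = {1, 3} ∨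
        ({1, 3} : Finset (ZMod 8)).image (· * s) = {5, 7}) ∧
      (((1 : ℕ) : ℂ) * (∑ a ∈ ({1, 3} : Finset (ZMod 8)), 𝐞 a + ∑ a ∈ ({5, 7} : Finset (ZMod 8)), 𝐞 a) +
          2 * ((0 : ℕ) : ℂ) = 0) ∧
      0 < ((((0 : ℕ) : ℂ)) + ((1 : ℕ) : ℂ) * ∑ a ∈ ({1, 3} : Finset (ZMod 8)), 𝐞 a).im := by
  refine ⟨fun s hs => ?_, ?_, ?_⟩
  · obtain ⟨u, rfl⟩ := hs
    have := ZMod.val_coe_unit_coprime u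
    revert this; generalize (u : ZMod 8) = s; revert s; decide
  · rw [Finset.sum_pair (by decide), Finset.sum_pair (by decide),
      show (3 : ZMod 8) = ((3 : ℕ) : ZMod 8) by norm_num, show (5 : ZMod 8) = ((5 : ℕ) : ZMod 8) by norm_num,
      show (7 : ZMod 8) = ((7 : ℕ) : ZMod 8) by norm_num]
    simp only [toCircle_natCast_eq_pow, Nat.cast_one, one_mul, Nat.cast_zero, mul_zero, add_zero]
    have h4 : (𝐞 (1 : ZMod 8)) ^ 4 = -1 := by
      have := toCircle_one_pow_half (f := 8) (by decide)
      norm_num at this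
      exact this
    linear_combination (𝐞 (1 : ZMod 8) + (𝐞 (1 : ZMod 8)) ^ 3) * h4
  · rw [Finset.sum_pair (by decide), show (3 : ZMod 8) = ((3 : ℕ) : ZMod 8) by norm_num]
    simp only [toCircle_natCast_eq_pow, Nat.cast_one, one_mul, Nat.cast_zero, zero_add, Complex.add_im,
      im_re_toCircle_one, im_re_toCircle_one_pow]
    have h1 : 0 < Real.sin (2 * π * (1 : ℕ) / (8 : ℕ)) :=
      Real.sin_pos_of_pos_of_lt_pi (by positivity) (by push_cast; nlinarith [Real.pi_pos])
    have h3 : 0 < Real.sin (2 * π * (3 : ℕ) / (8 : ℕ)) :=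
      Real.sin_pos_of_pos_of_lt_pi (by positivity) (by push_cast; nlinarith [Real.pi_pos])
    linarith

/-- **`K = ℚ(√−2)`, any level `n` with `8 ∣ n`: `Im φ(ζ^{n/8} + ζ^{3n/8}) < 0 ↔ t mod 8 ∈ {5, 7}`** (as
`{1,3}·t = {5,7}` in `ℤ/8`), non-zero, `Re = 0`, for `φ ζ = 𝐞_n(t)`, `t` a unit residue (`ζ^{n/8} + ζ^{3n/8} = √−2`
up to the embedding; `χ_{−8}(t) = −1 ⟺ t ≡ 5, 7 (mod 8)`).
research route conditional on HC_CM; not a corollary; Q11.4-sentence-2 already refuted in dim ≥ 3. [folklore] -/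
theorem im_embedding_sqrtNegTwo_neg_iff (h8 : 8 ∣ n) {φ : K →+* ℂ} {t : ZMod n} (hφ : φ ζ = 𝐞 t)
    (ht : t.val.Coprime n) :
    (((φ (ζ ^ (n / 8) + ζ ^ (n / 8 * 3))).im < 0 ↔
        ({1, 3} : Finset (ZMod 8)).image (· * ((t.val : ℕ) : ZMod 8)) = {5, 7}) ∧
      (φ (ζ ^ (n / 8) + ζ ^ (n / 8 * 3))).im ≠ 0) ∧ (φ (ζ ^ (n / 8) + ζ ^ (n / 8 * 3))).re = 0 := by
  obtain ⟨H1, H2, H3⟩ := hyps_eight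
  have hu := isUnit_cast_of_coprime h8 ht
  have hre0 := re_charSum_one_eq_zero ({1, 3} : Finset (ZMod 8)) {5, 7} 0 1 H2 (by decide)
  have hv1 : (1 : ZMod 8).val = 1 := rfl
  have hv3 : (3 : ZMod 8).val = 3 := rfl
  have helt : ζ ^ (n / 8) + ζ ^ (n / 8 * 3) =
      ((0 : ℕ) : K) + (1 : ℕ) * ∑ a ∈ ({1, 3} : Finset (ZMod 8)), ζ ^ (n / 8 * a.val) := by
    rw [Finset.sum_pair (by decide), hv1, hv3]; simp
  rw [helt, embedding_charSum_eq h8 hφ]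
  exact ⟨im_charSum_neg_iff _ _ 0 1 H1 H2 H3 hu, re_charSum_eq_zero _ _ 0 1 H1 H2 hre0 hu⟩

/-! ### §4 `K = ℚ(√−7)`: `δ = 1 + 2(η + η² + η⁴)`, `η = ζ^{n/7}`, `f = 7`, `S = {1,2,4}`, `S′ = {3,5,6}` -/

/-- (H1)–(H3) at `f = 7`: units carry `{1,2,4}` to itself or to `{3,5,6}`; `2Σ_{k=1}^{6} 𝐞₇(k) + 2 = 0`;
`Im(1 + 2(𝐞₇(1) + 𝐞₇(2) + 𝐞₇(4))) = 2(sin(2π/7) + sin(4π/7) − sin(π/7)) > 0`.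
research route conditional on HC_CM; not a corollary; Q11.4-sentence-2 already refuted in dim ≥ 3. [folklore] -/
theorem hyps_seven :
    (∀ s : ZMod 7, IsUnit s → ({1, 2, 4} : Finset (ZMod 7)).image (· * s) = {1, 2, 4} ∨
        ({1, 2, 4} : Finset (ZMod 7)).image (· * s) = {3, 5, 6}) ∧
      (((2 : ℕ) : ℂ) * (∑ a ∈ ({1, 2, 4} : Finset (ZMod 7)), 𝐞 a + ∑ a ∈ ({3, 5, 6} : Finset (ZMod 7)), 𝐞 a) +
          2 * ((1 : ℕ) : ℂ) = 0) ∧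
      0 < ((((1 : ℕ) : ℂ)) + ((2 : ℕ) : ℂ) * ∑ a ∈ ({1, 2, 4} : Finset (ZMod 7)), 𝐞 a).im := by
  refine ⟨fun s hs => ?_, ?_, ?_⟩
  · obtain ⟨u, rfl⟩ := hs
    have := ZMod.val_coe_unit_coprime u
    revert this; generalize (u : ZMod 7) = s; revert s; decide
  · rw [Finset.sum_insert (by decide), Finset.sum_pair (by decide), Finset.sum_insert (by decide),
      Finset.sum_pair (by decide), show (2 : ZMod 7) = ((2 : ℕ) : ZMod 7) by norm_num,
      show (3 : ZMod 7) = ((3 : ℕ) : ZMod 7) by norm_num, show (4 : ZMod 7) = ((4 : ℕ) : ZMod 7) by norm_num,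
      show (5 : ZMod 7) = ((5 : ℕ) : ZMod 7) by norm_num, show (6 : ZMod 7) = ((6 : ℕ) : ZMod 7) by norm_num]
    simp only [toCircle_natCast_eq_pow]
    have hg := geom_sum_toCircle_one (f := 7) (by norm_num)
    simp only [Finset.sum_range_succ, Finset.sum_range_zero, zero_add, pow_zero, pow_one] at hg
    push_cast
    linear_combination 2 * hg
  · rw [Finset.sum_insert (by decide), Finset.sum_pair (by decide), show (2 : ZMod 7) = ((2 : ℕ) : ZMod 7) by
      norm_num, show (4 : ZMod 7) = ((4 : ℕ) : ZMod 7) by norm_num]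
    simp only [toCircle_natCast_eq_pow]
    simp only [Complex.add_im, Complex.mul_im, Complex.natCast_re, Complex.natCast_im, zero_mul, add_zero,
      im_re_toCircle_one, im_re_toCircle_one_pow]
    have hπ := Real.pi_pos
    have e4 : Real.sin (2 * π * (4 : ℕ) / (7 : ℕ)) = -Real.sin (π / 7) := by
      rw [show (2 * π * (4 : ℕ) / (7 : ℕ) : ℝ) = π / 7 + π by push_cast; ring, Real.sin_add_pi]
    have h12 : Real.sin (π / 7) < Real.sin (2 * π * (1 : ℕ) / (7 : ℕ)) := by
      apply Real.sin_lt_sin_of_lt_of_le_pi_div_two <;> push_cast <;> nlinarith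
    have h2 : 0 < Real.sin (2 * π * (2 : ℕ) / (7 : ℕ)) :=
      Real.sin_pos_of_pos_of_lt_pi (by positivity) (by push_cast; nlinarith)
    push_cast at e4 h12 h2 ⊢
    nlinarith

/-- **`K = ℚ(√−7)`, any level `n` with `7 ∣ n`: `Im φ(1 + 2(η + η² + η⁴)) < 0 ↔ t mod 7 ∈ {3, 5, 6}`**
(`η = ζ^{n/7}`; as `{1,2,4}·t = {3,5,6}` in `ℤ/7`), non-zero, `Re = 0`, for `φ ζ = 𝐞_n(t)`, `t` a unit residue
(`1 + 2(η + η² + η⁴) = Σ (a/7)η^a = √−7` up to the embedding; `χ_{−7}(t) = −1 ⟺ t mod 7 ∉ {1,2,4}`).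
research route conditional on HC_CM; not a corollary; Q11.4-sentence-2 already refuted in dim ≥ 3. [cite: Washington1997, Lemma 4.8] -/
theorem im_embedding_sqrtNegSeven_neg_iff (h7 : 7 ∣ n) {φ : K →+* ℂ} {t : ZMod n} (hφ : φ ζ = 𝐞 t)
    (ht : t.val.Coprime n) :
    (((φ (1 + 2 * (ζ ^ (n / 7) + ζ ^ (n / 7 * 2) + ζ ^ (n / 7 * 4)))).im < 0 ↔
        ({1, 2, 4} : Finset (ZMod 7)).image (· * ((t.val : ℕ) : ZMod 7)) = {3, 5, 6}) ∧
      (φ (1 + 2 * (ζ ^ (n / 7) + ζ ^ (n / 7 * 2) + ζ ^ (n / 7 * 4)))).im ≠ 0) ∧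
      (φ (1 + 2 * (ζ ^ (n / 7) + ζ ^ (n / 7 * 2) + ζ ^ (n / 7 * 4)))).re = 0 := by
  obtain ⟨H1, H2, H3⟩ := hyps_seven
  have hu := isUnit_cast_of_coprime h7 ht
  have hre0 := re_charSum_one_eq_zero ({1, 2, 4} : Finset (ZMod 7)) {3, 5, 6} 1 2 H2 (by decide)
  have hv1 : (1 : ZMod 7).val = 1 := rfl
  have hv2 : (2 : ZMod 7).val = 2 := rfl
  have hv4 : (4 : ZMod 7).val = 4 := rfl
  have helt : (1 + 2 * (ζ ^ (n / 7) + ζ ^ (n / 7 * 2) + ζ ^ (n / 7 * 4)) : K) =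
      ((1 : ℕ) : K) + (2 : ℕ) * ∑ a ∈ ({1, 2, 4} : Finset (ZMod 7)), ζ ^ (n / 7 * a.val) := by
    rw [Finset.sum_insert (by decide), Finset.sum_pair (by decide), hv1, hv2, hv4]; push_cast; ring
  rw [helt, embedding_charSum_eq h7 hφ]
  exact ⟨im_charSum_neg_iff _ _ 1 2 H1 H2 H3 hu, re_charSum_eq_zero _ _ 1 2 H1 H2 hre0 hu⟩

end Summit.HodgeConjecture.Ring2WeilCoverage.ResidueDictionaryPieces

end
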